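import Mathlib.Algebra.Polynomial.Eval.Defs
import Literature.Computability.Cryptography.NaorReingoldTC0
import HarnessLib

/-!
# The Naor–Reingold functions in `TC⁰`, III: polynomial size, and Theorem 4.5

The size `NRTC0.nrSize n` of the depth-`30` threshold circuit of `NaorReingoldTC0.lean` for one
output bit of `f_{P,Q,g,ā}` depends on `n` alone (through the prime sets
`S₁ = primeSet (n(n+1))`, `S₂ = primeSet (B₂ n)` and the widths derived from them). Here we bound
it by an explicit polynomial: every size function of the construction is monotone, the number of
primes `≤ primeBound B` is at most `primeBound B + 1 = 2B + 2^24 + 9`, and the range `R N` of the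
iterated-addition circuit is `≤ 4N² + 4N + 1` (`ItAdd.R_le`); substituting these bounds gives an
expression `nrSizeR n` built from `n` by `+` and `·` only, which we write ONCE for an arbitrary
commutative semiring so that the same expression evaluated in `ℕ[X]` is the required polynomial
(`eval_nrSizeR`). This proves the named fact `NaorReingold2004_thm45` (Naor–Reingold 2004,
Thm. 4.5) as stated in `NaorReingoldDDH.lean`: depth `30`, size `nrSizeR n`.

## References

* M. Naor, O. Reingold, *Number-theoretic constructions of efficient pseudo-random functions*,
  J. ACM 51 (2004), Thm. 4.5 (p. 252).
-/

noncomputable section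

namespace Literature.Computability.Cryptography

open Finset Complexity Complexity.SmallPrimes Complexity.ItAdd Polynomial

namespace NRTC0

/-! ### The size bound as a semiring expression -/

section Semiring

variable {R : Type*} [CommSemiring R]

/-- `quotRange` as a semiring expression. [folklore] -/
def quotRangeR (k : R) : R := k * (4 * k + 1) + 1

/-- `resBitSize` as a semiring expression. [folklore] -/
def resBitSizeR (c L : R) : R := 4 * c + 14 + (c * L + 1) * (8 * (c * L) + 15)

/-- `crtLayerSize` as a semiring expression. [folklore] -/
def crtLayerSizeR (c k L : R) : R :=
  quotRangeR k * (4 * (k * (L + 1) * (4 * k + 1) + quotRangeR k) + 11) +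
    k * (L + 1) * resBitSizeR c L

/-- The bound `4N² + 4N + 1` for `ItAdd.R N`. [folklore] -/
def RbR (N : R) : R := 4 * N * N + 4 * N + 1

/-- The bound for `ItAdd.itAddSize N W'` with `R N` replaced by `RbR N`. [folklore] -/
def itAddBoundR (N W' : R) : R :=
  2 * W' * RbR N * (4 * (RbR N + RbR N) + 11) +
    W' * (2 * (2 * (((W' + 1) * ((W' + 2) * (RbR N * RbR N * 1 + 1) + 1) + 1) +
      (RbR N * RbR N * 1 + 1) + 1) + 1) + 1)

/-- Bound for `L₁ n = primeBound (n(n+1))`. [folklore] -/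
def L1R (x : R) : R := 2 * (x * (x + 1)) + 2 ^ 24 + 8

/-- Bound for `|S₁ n|`. [folklore] -/
def k1R (x : R) : R := L1R x + 1

/-- Bound for `card (WiresB n)`. [folklore] -/
def cBR (x : R) : R := quotRangeR (k1R x) + k1R x * (L1R x + 1)

/-- Bound for `L₂ n`. [folklore] -/
def L2R (x : R) : R := 2 * (x * (cBR x + 1)) + 2 ^ 24 + 8

/-- Bound for `|S₂ n|`. [folklore] -/
def k2R (x : R) : R := L2R x + 1

/-- Bound for `Nn n = card (WiresD n) + 1`. [folklore] -/
def NnR (x : R) : R := quotRangeR (k2R x) + k2R x * (L2R x + 1) + 1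

/-- Bound for `WU n`. [folklore] -/
def WUR (x : R) : R := x + quotRangeR (k2R x) + k2R x + 1

/-- Bound for `qmax n`. [folklore] -/
def qmR (x : R) : R := 2 * k2R x + 1

/-- **The size bound** `nrSizeR`: `nrSize n ≤ nrSizeR n`, and `nrSizeR X ∈ ℕ[X]`. [folklore] -/
def nrSizeR (x : R) : R :=
  qmR x * 2 + 1 + (qmR x + 1) * 2 * (itAddBoundR (NnR x) (x + qmR x + 1) + NnR x * WUR x * 1) +
    (crtLayerSizeR (cBR x) (k2R x) (L2R x) + crtLayerSizeR x (k1R x) (L1R x))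

variable {S : Type*} [CommSemiring S] (f : R →+* S)

/-- Ring homomorphisms commute with `quotRangeR`. [folklore] -/
theorem map_quotRangeR (k : R) : f (quotRangeR k) = quotRangeR (f k) := by
  simp [quotRangeR, map_ofNat]

/-- … with `resBitSizeR`. [folklore] -/
theorem map_resBitSizeR (c L : R) : f (resBitSizeR c L) = resBitSizeR (f c) (f L) := by
  simp [resBitSizeR, map_ofNat]

/-- … with `crtLayerSizeR`. [folklore] -/
theorem map_crtLayerSizeR (c k L : R) :
    f (crtLayerSizeR c k L) = crtLayerSizeR (f c) (f k) (f L) := by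
  simp [crtLayerSizeR, map_quotRangeR, map_resBitSizeR, map_ofNat]

/-- … with `RbR`. [folklore] -/
theorem map_RbR (N : R) : f (RbR N) = RbR (f N) := by simp [RbR, map_ofNat]

/-- … with `itAddBoundR`. [folklore] -/
theorem map_itAddBoundR (N W' : R) : f (itAddBoundR N W') = itAddBoundR (f N) (f W') := by
  simp [itAddBoundR, map_RbR, map_ofNat]

/-- … with `L1R`. [folklore] -/
theorem map_L1R (x : R) : f (L1R x) = L1R (f x) := by simp [L1R, map_ofNat]

/-- … with `k1R`. [folklore] -/
theorem map_k1R (x : R) : f (k1R x) = k1R (f x) := by simp [k1R, map_L1R]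

/-- … with `cBR`. [folklore] -/
theorem map_cBR (x : R) : f (cBR x) = cBR (f x) := by
  simp [cBR, map_quotRangeR, map_k1R, map_L1R]

/-- … with `L2R`. [folklore] -/
theorem map_L2R (x : R) : f (L2R x) = L2R (f x) := by simp [L2R, map_cBR, map_ofNat]

/-- … with `k2R`. [folklore] -/
theorem map_k2R (x : R) : f (k2R x) = k2R (f x) := by simp [k2R, map_L2R]

/-- … with `NnR`. [folklore] -/
theorem map_NnR (x : R) : f (NnR x) = NnR (f x) := by
  simp [NnR, map_quotRangeR, map_k2R, map_L2R]

/-- … with `WUR`. [folklore] -/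
theorem map_WUR (x : R) : f (WUR x) = WUR (f x) := by
  simp [WUR, map_quotRangeR, map_k2R]

/-- … with `qmR`. [folklore] -/
theorem map_qmR (x : R) : f (qmR x) = qmR (f x) := by simp [qmR, map_k2R, map_ofNat]

/-- … with `nrSizeR`. [folklore] -/
theorem map_nrSizeR (x : R) : f (nrSizeR x) = nrSizeR (f x) := by
  simp [nrSizeR, map_qmR, map_itAddBoundR, map_NnR, map_WUR, map_crtLayerSizeR, map_cBR,
    map_k2R, map_L2R, map_k1R, map_L1R, map_ofNat]

end Semiring

/-- **The size polynomial**: `nrSizeR X` evaluates to `nrSizeR n`. [folklore] -/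
theorem eval_nrSizeR (n : ℕ) : (nrSizeR (X : ℕ[X])).eval n = nrSizeR n := by
  have h := map_nrSizeR (Polynomial.evalRingHom n) (X : ℕ[X])
  rwa [Polynomial.coe_evalRingHom, Polynomial.eval_X] at h

/-! ### Comparing the sizes with the bound -/

/-- `quotRange = quotRangeR` on `ℕ`. [folklore] -/
theorem quotRange_eq (k : ℕ) : quotRange k = quotRangeR k := rfl

/-- `resBitSize = resBitSizeR` on `ℕ`. [folklore] -/
theorem resBitSize_eq (c L : ℕ) : resBitSize c L = resBitSizeR c L := rfl

/-- `crtLayerSize = crtLayerSizeR` on `ℕ`. [folklore] -/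
theorem crtLayerSize_eq (c k L : ℕ) : crtLayerSize c k L = crtLayerSizeR c k L := rfl

/-- `itAddSize N W' ≤ itAddBoundR N W'` (via `R N ≤ 4N² + 4N + 1`). [folklore] -/
theorem itAddSize_le (N W' : ℕ) : itAddSize N W' ≤ itAddBoundR N W' := by
  have hR : ItAdd.R N ≤ RbR N := by unfold RbR; exact ItAdd.R_le N
  unfold itAddSize itAddBoundR l1Blk bitBlk bBlk termBlk pairBlk
  rw [Fintype.card_prod, Fintype.card_prod, Fintype.card_bool, Fintype.card_fin, Fintype.card_fin]
  calc 2 * (W' * ItAdd.R N) * (4 * (ItAdd.R N + ItAdd.R N) + 11) +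
        W' * (2 * (2 * ((W' + 1) * ((W' + 2) * (ItAdd.R N * ItAdd.R N * 1 + 1) + 1) + 1 +
          (ItAdd.R N * ItAdd.R N * 1 + 1) + 1) + 1) + 1)
      ≤ 2 * (W' * RbR N) * (4 * (RbR N + RbR N) + 11) +
        W' * (2 * (2 * ((W' + 1) * ((W' + 2) * (RbR N * RbR N * 1 + 1) + 1) + 1 +
          (RbR N * RbR N * 1 + 1) + 1) + 1) + 1) := by gcongr
    _ = _ := by ring

/-- `itAddBoundR` is monotone on `ℕ`. [folklore] -/
theorem itAddBoundR_mono {N N' W W' : ℕ} (hN : N ≤ N') (hW : W ≤ W') :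
    itAddBoundR N W ≤ itAddBoundR N' W' := by
  have hR : RbR N ≤ RbR N' := by unfold RbR; gcongr
  unfold itAddBoundR
  gcongr

/-- `L₁ n = L1R n`. [folklore] -/
theorem L₁_eq (n : ℕ) : L₁ n = L1R n := rfl

/-- `|S₁ n| ≤ k1R n`. [folklore] -/
theorem card_S₁_le (n : ℕ) : (S₁ n).card ≤ k1R n :=
  (Finset.card_filter_le _ _).trans (by rw [Finset.card_range, k1R, ← L₁_eq]; rfl)

/-- `card (WiresB n) ≤ cBR n`. [folklore] -/
theorem card_WiresB_le (n : ℕ) : Fintype.card (WiresB n) ≤ cBR n := by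
  rw [Fintype.card_sum, Fintype.card_fin, Fintype.card_prod, Fintype.card_coe, Fintype.card_fin]
  unfold cBR
  rw [← quotRange_eq, ← L₁_eq]
  have h := card_S₁_le n
  exact Nat.add_le_add (quotRange_mono h) (Nat.mul_le_mul_right _ h)

/-- `L₂ n ≤ L2R n`. [folklore] -/
theorem L₂_le (n : ℕ) : L₂ n ≤ L2R n := by
  unfold L₂ B₂ SmallPrimes.primeBound L2R
  have := card_WiresB_le n
  gcongr

/-- `|S₂ n| ≤ k2R n`. [folklore] -/
theorem card_S₂_le (n : ℕ) : (S₂ n).card ≤ k2R n :=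
  ((Finset.card_filter_le _ _).trans (by rw [Finset.card_range]; rfl)).trans
    (Nat.succ_le_succ (L₂_le n))

/-- `Nn n ≤ NnR n`. [folklore] -/
theorem Nn_le (n : ℕ) : Nn n ≤ NnR n := by
  unfold Nn NnR
  rw [Fintype.card_option, Fintype.card_sum, Fintype.card_fin, Fintype.card_prod, Fintype.card_coe,
    Fintype.card_fin, ← quotRange_eq]
  have h := card_S₂_le n
  have hL := L₂_le n
  gcongr
  exact quotRange_mono h

/-- `WU n ≤ WUR n`. [folklore] -/
theorem WU_le (n : ℕ) : WU n ≤ WUR n := by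
  unfold WU WUR
  rw [← quotRange_eq]
  have h := card_S₂_le n
  gcongr
  exact quotRange_mono h

/-- `qmax n ≤ qmR n`. [folklore] -/
theorem qmax_le (n : ℕ) : qmax n ≤ qmR n := by
  unfold qmax qmR
  have h := card_S₂_le n
  gcongr

/-- **The size of the circuit is at most the bound.** [folklore] -/
theorem nrSize_le (n : ℕ) : nrSize n ≤ nrSizeR n := by
  have hq := qmax_le n
  have hN := Nn_le n
  have hWU := WU_le n
  have hk1 := card_S₁_le n
  have hk2 := card_S₂_le n
  have hcB := card_WiresB_le n
  have hL2 := L₂_le n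
  have h1 : bitsSizeG (Nn n) (WU n) (Wtop n + 1) (qmax n) ≤
      (qmR n + 1) * 2 * (itAddBoundR (NnR n) (n + qmR n + 1) + NnR n * WUR n * 1) := by
    unfold bitsSizeG candSizeG Wtop
    rw [Fintype.card_prod, Fintype.card_fin, Fintype.card_bool, Fintype.card_prod,
      Fintype.card_fin, Fintype.card_fin]
    have hA : itAddSize (Nn n) (n + qmax n + 1) ≤ itAddBoundR (NnR n) (n + qmR n + 1) :=
      (itAddSize_le _ _).trans (itAddBoundR_mono hN (by omega))
    gcongr
  have h2 : wiresSize n ≤ crtLayerSizeR (cBR n) (k2R n) (L2R n) + crtLayerSizeR n (k1R n) (L1R n) := by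
    unfold wiresSize
    rw [← crtLayerSize_eq, ← crtLayerSize_eq, ← L₁_eq]
    exact Nat.add_le_add (crtLayerSize_mono hcB hk2 hL2) (crtLayerSize_mono le_rfl hk1 le_rfl)
  unfold nrSize nrSizeR
  gcongr

end NRTC0

/-! ### Theorem 4.5 -/

open NRTC0 in
/-- **Naor–Reingold 2004, Theorem 4.5, proved**: every output bit of every function
`f_{P,Q,g,ā}` of Construction 4.1 (`⟨P, Q, g⟩` a DDH instance at security parameter `n` = input
length, `aᵢ < Q`) is computed by a threshold circuit over `tcBasis` of depth `30` and size
`nrSizeR n`, a fixed polynomial in `n` — two multiple products by Chinese remaindering with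
discrete logarithms modulo small primes, the first kept in CRT representation inside the
exponent of `g`, the second reduced modulo `P` by iterated addition of preprocessed residues and
a comparison with the multiples of `P` (§4.2–4.2.1 of the paper; Vollmer 1999, Thms. 1.37, 1.40). [cite: NaorReingold2004, Thm. 4.5 (p. 252) and §4.2.1] -/
theorem NaorReingold2004_thm45_holds : NaorReingold2004_thm45 := by
  refine ⟨30, nrSizeR (X : ℕ[X]), fun n P Q g a hI ha j => ?_⟩
  have hj : (j : ℕ) < Wtop n + 1 := by have := j.2; unfold Wtop; omega
  obtain ⟨C, hB, hd, hs, hC⟩ :=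
    (acRealOver_nrBit (n := n) (P := P) (Q := Q) (g := g) a hj).toCircuit
  refine ⟨C, hB, hd, hs.trans ?_, fun x => (hC x).trans (nrBit_eq hI ha j x)⟩
  rw [eval_nrSizeR]
  exact nrSize_le n

end Literature.Computability.Cryptography

end
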